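import Literature.NumberTheory.LFunctions.DedekindZetaRealZerosUniform
import HarnessLib

/-!
# The zero-free region of the Dedekind zeta function, uniformly in the field

Topic `Literature/NumberTheory/LFunctions` (namespace `Literature.NumberTheory.LFunctions.NumberField`).
Everything in this file is PROVED (theorems only).

**Theorem** (`exists_zeroFree_dedekindZeta₁`; Lagarias–Odlyzko [LO, Lemma 8.1 & 8.2], Stark 1974,
[ThornerZaman2019, Theorem 3.1] for `χ = 1`): for every `n` there is `c = c(n) > 0` such that for
every number field `K` of degree `n`, every zero `ρ = β + iγ` of `ζ_K` with
`β > 1 − c/(log|d_K| + log(|γ| + 4))` is REAL. (Together with `DedekindZetaRealZerosUniform.lean`: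
there is at most one such zero and it is simple.)

The proof is de la Vallée-Poussin's, with Stark's device for the zeros close to `1` — no
continuity or compactness argument in `K` is used, so the constant depends on `n` alone:

* the local partial fraction of `ζ₁_K'/ζ₁_K = 1/(s−1) − L(Λ_K, s)` with true multiplicities at
  every height (`DedekindZetaPartialFraction.lean`, Lagarias–Odlyzko Lemma 5.6) gives, dropping all
  but prescribed zeros (`re_LSeries_vonMangoldtNorm_le_of_zeros`),
  `Re L(Λ_K, s) ≤ Re 1/(s−1) − Σ_{ρ prescribed} m(ρ) Re 1/(s−ρ) + K'ℒ(t)`,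
  `ℒ(t) = log|d_K| + log(|t| + 4)`, `K' = 77760(5n+2)` (this replaces MV's Lemma 6.4/11.1 AND the
  pole bookkeeping: the term `Re 1/(s − 1)` IS the pole);
* FAR zeros, `|γ| ≥ 30(1 − β)`: `3–4–1` for `Λ_K` (`ClassicalZFRData.three_four_one`) at
  `σ = 1 + 6(1−β)` and heights `0, γ, 2γ`, exactly as Montgomery–Vaughan Theorem 6.6 / 11.3 Case 2
  (`1/2 + 1/39 + 1/606 − 4/7 < −1/25`);
* NEAR zeros, `0 < |γ| < 30(1 − β)`: `ζ₁_K(s̄) = conj ζ₁_K(s)` (`dedekindZeta₁_conj`), so `ρ̄ ≠ ρ` is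
  a zero too, and at the REAL point `σ = 1 + 62(1 − β)` the trivial positivity `L(Λ_K, σ) ≥ 0`
  against the two zeros gives `0 ≤ 1/(62u) − 126/(4869u) + K'ℒ₀` (Stark's lemma: a disc of radius
  `≍ 1/log d_K` about `1` contains at most one zero, necessarily real);
* zeros ON `σ = 1` do not exist (`dedekindZeta₁_ne_zero_of_one_le_re`, the tree's non-vanishing).

## References

* J. C. Lagarias, A. M. Odlyzko, *Effective versions of the Chebotarev density theorem* (1977),
  Lemmas 5.6, 8.1, 8.2. [LagariasOdlyzko1977]
* H. M. Stark, *Some effective cases of the Brauer–Siegel theorem*, Invent. Math. 23 (1974),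
  Lemma 3. [folklore]
* H. L. Montgomery, R. C. Vaughan, *Multiplicative Number Theory I*, CUP 2007, Theorems 6.6, 11.3.
  [MontgomeryVaughan2007]
* J. Thorner, A. Zaman, *A unified and improved Chebotarev density theorem*, ANT 13 (2019),
  Theorem 3.1. [ThornerZaman2019]
-/

noncomputable section

open scoped NumberField nonZeroDivisors ComplexConjugate
open Complex Filter Topology Set Metric MeromorphicOn NumberField

namespace Literature.NumberTheory.LFunctions.NumberField

variable {K : Type*} [Field K] [NumberField K]

/-! ### Conjugation symmetry of `ζ₁_K` -/

/-- For real `σ > 1`, the Dirichlet series `ζ_K(σ)` is real: `conj ζ_K(σ̄) = ζ_K(σ)` for `Re s > 1`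
in the form `conj (ζ_K (conj s)) = ζ_K(s)` (natural-number coefficients). [folklore] -/
theorem conj_dedekindZeta_conj (s : ℂ) :
    conj (_root_.NumberField.dedekindZeta K (conj s)) = _root_.NumberField.dedekindZeta K s := by
  rw [_root_.NumberField.dedekindZeta, _root_.NumberField.dedekindZeta, LSeries, LSeries, Complex.conj_tsum]
  congr 1
  funext n
  rcases eq_or_ne n 0 with rfl | hn
  · simp [LSeries.term]
  · rw [LSeries.term_of_ne_zero hn, LSeries.term_of_ne_zero hn, map_div₀, Complex.conj_natCast]
    congr 1
    have harg : Complex.arg ((n : ℕ) : ℂ) ≠ Real.pi := by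
      rw [show ((n : ℕ) : ℂ) = ((n : ℝ) : ℂ) by push_cast; rfl,
        Complex.arg_ofReal_of_nonneg (Nat.cast_nonneg n)]
      exact Real.pi_ne_zero.symm
    calc conj (((n : ℕ) : ℂ) ^ (conj s)) = conj ((conj ((n : ℕ) : ℂ)) ^ (conj s)) := by
          rw [Complex.conj_natCast]
      _ = ((n : ℕ) : ℂ) ^ (conj (conj s)) := (Complex.cpow_conj _ _ harg).symm
      _ = ((n : ℕ) : ℂ) ^ s := by rw [Complex.conj_conj]

/-- **`ζ₁_K(s̄) = conj ζ₁_K(s)`** for all `s` (`ζ₁_K = (s−1)ζ_K` entire, real on the real axis beyond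
`1`; identity theorem). [folklore] -/
theorem conj_dedekindZeta₁_conj (s : ℂ) : conj (dedekindZeta₁ K (conj s)) = dedekindZeta₁ K s := by
  have hf : AnalyticOnNhd ℂ (dedekindZeta₁ K) Set.univ := analyticOnNhd_dedekindZeta₁ K _
  have hgdiff : Differentiable ℂ (conj ∘ dedekindZeta₁ K ∘ conj) := fun _ ↦
    differentiableAt_conj_conj_iff.mpr (dedekindZeta₁_differentiable K _)
  have hg : AnalyticOnNhd ℂ (conj ∘ dedekindZeta₁ K ∘ conj) Set.univ := fun z _ ↦ hgdiff.analyticAt z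
  have hfg : (conj ∘ dedekindZeta₁ K ∘ conj) =ᶠ[𝓝 (2 : ℂ)] dedekindZeta₁ K := by
    have hmem : {s : ℂ | 1 < s.re} ∈ 𝓝 (2 : ℂ) :=
      (isOpen_lt continuous_const continuous_re).mem_nhds (by simp)
    filter_upwards [hmem] with w hw
    have hw' : 1 < (conj w).re := by rwa [Complex.conj_re]
    simp only [Function.comp_apply]
    rw [dedekindZeta₁_apply_eq_mul hw', dedekindZeta₁_apply_eq_mul hw, map_mul, map_sub, map_one,
      Complex.conj_conj, conj_dedekindZeta_conj w]
  have := hg.eqOn_of_preconnected_of_eventuallyEq hf isPreconnected_univ (Set.mem_univ _) hfg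
    (Set.mem_univ s)
  simpa using this

/-- The zeros of `ζ₁_K` are symmetric under conjugation. [folklore] -/
theorem dedekindZeta₁_conj_eq_zero {ρ : ℂ} (hρ : dedekindZeta₁ K ρ = 0) : dedekindZeta₁ K (conj ρ) = 0 := by
  have h := conj_dedekindZeta₁_conj (K := K) (conj ρ)
  rw [Complex.conj_conj, hρ, map_zero] at h
  exact h.symm

/-! ### The partial fraction with prescribed zeros, at any height -/

/-- **`Re L(Λ_K, s) ≤ Re 1/(s−1) − Σ_{ρ ∈ T} k(ρ) Re 1/(s−ρ) + 77760 M_K(t)`** for `1 < σ ≤ 2`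
(`s = σ + it`), any finite set `T` of zeros `ρ` of `ζ₁_K` in `|ρ − (2 + it)| ≤ 31/16` with
prescribed multiplicities `k(ρ) ≤ ord_ρ ζ₁_K`: the local partial fraction of `ζ₁_K'/ζ₁_K` with all
other zeros dropped. [cite: LagariasOdlyzko1977, Lemma 5.6] -/
theorem re_LSeries_vonMangoldtNorm_le_of_zeros {s : ℂ} (hs : 1 < s.re) (hs2 : s.re ≤ 2)
    (T : Finset ℂ) (k : ℂ → ℕ)
    (hT : ∀ u ∈ T, dedekindZeta₁ K u = 0 ∧ u ∈ closedBall (2 + s.im * I) (31 / 16) ∧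
      (k u : ℕ∞) ≤ analyticOrderAt (dedekindZeta₁ K) u) :
    (LSeries (fun n ↦ (vonMangoldtNorm K n : ℂ)) s).re ≤
      (1 / (s - 1)).re - ∑ u ∈ T, (k u : ℝ) * ((s - u)⁻¹).re + 77760 * discBound K s.im := by
  classical
  set f := dedekindZeta₁ K with hf
  set t : ℝ := s.im with ht
  set c : ℂ := 2 + t * I with hc
  have hsc : s ∈ closedBall c (7 / 4) := by
    rw [mem_closedBall, dist_eq_norm]
    have : s - c = ((s.re - 2 : ℝ) : ℂ) := by apply Complex.ext <;> simp [hc, ht]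
    rw [this, Complex.norm_real, Real.norm_eq_abs, abs_le]
    constructor <;> linarith
  have hfs : f s ≠ 0 := dedekindZeta₁_ne_zero_of_one_le_re hs.le
  have hpf := norm_logDeriv_dedekindZeta₁_sub_sum_le K t hsc hfs
  set D := divisor f (closedBall c (31 / 16)) with hD
  set S := (D.finiteSupport (isCompact_closedBall _ _)).toFinset with hS
  have han := analyticOnNhd_dedekindZeta₁ K (closedBall c (31 / 16))
  have hterm_re : ∀ u : ℂ, ((D u : ℂ) / (s - u)).re = (D u : ℝ) * ((s - u)⁻¹).re := fun u ↦ by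
    rw [div_eq_mul_inv, show ((D u : ℤ) : ℂ) = ((D u : ℝ) : ℂ) by simp, Complex.re_ofReal_mul]
  have hDnn : ∀ u, (0 : ℝ) ≤ D u := fun u ↦ by exact_mod_cast han.divisor_nonneg u
  have hinv_nn : ∀ u : ℂ, dedekindZeta₁ K u = 0 → 0 ≤ ((s - u)⁻¹).re := by
    intro u hu
    have hu1 : u.re < 1 := by
      by_contra h
      exact dedekindZeta₁_ne_zero_of_one_le_re (K := K) (not_lt.mp h) hu
    rw [Complex.inv_re]
    exact div_nonneg (by simp; linarith) (Complex.normSq_nonneg _)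
  have hSzero : ∀ u ∈ S, dedekindZeta₁ K u = 0 := fun u hu ↦ (zero_of_mem_support_divisor_bigDisc hu).1
  have hterm_nn : ∀ u ∈ S, 0 ≤ ((D u : ℂ) / (s - u)).re := fun u hu ↦ by
    rw [hterm_re u]; exact mul_nonneg (hDnn u) (hinv_nn u (hSzero u hu))
  have hDk : ∀ u ∈ T, (k u : ℤ) ≤ D u := fun u hu ↦
    natCast_le_divisor_of_le_analyticOrderAt han (hT u hu).2.1 (hT u hu).2.2
      (analyticOrderAt_dedekindZeta₁_ne_top u)
  -- `Σ_{T} k Re(1/(s-u)) ≤ Re Σ_{S} D/(s-u)`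
  have hsum_ge : ∑ u ∈ T, (k u : ℝ) * ((s - u)⁻¹).re ≤ (∑ u ∈ S, (D u : ℂ) / (s - u)).re := by
    rw [Complex.re_sum]
    have hle1 : ∑ u ∈ T, (k u : ℝ) * ((s - u)⁻¹).re ≤ ∑ u ∈ T, (D u : ℝ) * ((s - u)⁻¹).re :=
      Finset.sum_le_sum fun u hu ↦ mul_le_mul_of_nonneg_right (by exact_mod_cast hDk u hu)
        (hinv_nn u (hT u hu).1)
    refine hle1.trans ?_
    have hsub' : ∀ u ∈ T, u ∉ S → (D u : ℝ) * ((s - u)⁻¹).re ≤ 0 := by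
      intro u _ huS
      have hDu : D u = 0 := by
        by_contra hne
        exact huS (by rw [hS, Set.Finite.mem_toFinset, Function.mem_support]; exact hne)
      rw [hDu]; simp
    calc ∑ u ∈ T, (D u : ℝ) * ((s - u)⁻¹).re
        = ∑ u ∈ T.filter (fun u ↦ u ∈ S), (D u : ℝ) * ((s - u)⁻¹).re +
            ∑ u ∈ T.filter (fun u ↦ ¬ u ∈ S), (D u : ℝ) * ((s - u)⁻¹).re :=
          (Finset.sum_filter_add_sum_filter_not _ _ _).symm
      _ ≤ ∑ u ∈ T.filter (fun u ↦ u ∈ S), (D u : ℝ) * ((s - u)⁻¹).re := by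
          have : ∑ u ∈ T.filter (fun u ↦ ¬ u ∈ S), (D u : ℝ) * ((s - u)⁻¹).re ≤ 0 :=
            Finset.sum_nonpos fun u hu ↦ by
              rw [Finset.mem_filter] at hu
              exact hsub' u hu.1 hu.2
          linarith
      _ ≤ ∑ u ∈ S, (D u : ℝ) * ((s - u)⁻¹).re := by
          refine Finset.sum_le_sum_of_subset_of_nonneg (fun u hu ↦ (Finset.mem_filter.mp hu).2)
            fun u hu _ ↦ ?_
          rw [← hterm_re]; exact hterm_nn u hu
      _ = ∑ u ∈ S, ((D u : ℂ) / (s - u)).re := Finset.sum_congr rfl fun u _ ↦ (hterm_re u).symm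
  have hL : LSeries (fun n ↦ (vonMangoldtNorm K n : ℂ)) s =
      1 / (s - 1) - (∑ u ∈ S, (D u : ℂ) / (s - u)) - (logDeriv f s - ∑ u ∈ S, (D u : ℂ) / (s - u)) := by
    rw [logDeriv_dedekindZeta₁_eq hs]; ring
  rw [hL, Complex.sub_re, Complex.sub_re]
  have h1 := Complex.abs_re_le_norm (logDeriv f s - ∑ u ∈ S, (D u : ℂ) / (s - u))
  have h2 := neg_abs_le (logDeriv f s - ∑ u ∈ S, (D u : ℂ) / (s - u)).re
  linarith

/-! ### The zero-free region -/

/-- Order `≥ 1` at a zero. [folklore] -/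
theorem one_le_analyticOrderAt_dedekindZeta₁ {u : ℂ} (hu : dedekindZeta₁ K u = 0) :
    ((1 : ℕ) : ℕ∞) ≤ analyticOrderAt (dedekindZeta₁ K) u := by
  have hne0 : analyticOrderAt (dedekindZeta₁ K) u ≠ 0 := by
    rw [ne_eq, ((dedekindZeta₁_differentiable K).analyticAt _).analyticOrderAt_eq_zero, not_not]
    exact hu
  exact Order.one_le_iff_ne_zero.mpr hne0

set_option maxHeartbeats 800000 in
/-- **FAR zeros** (`|γ| ≥ 30(1 − β)`): if `ρ = β + iγ` is a zero of `ζ₁_K` with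
`0 < 1 − β ≤ 1/64` and `|γ| ≥ 30(1 − β)`, then `(1/25)/(1 − β) ≤ 9 K'(log|d_K| + log(|γ| + 4))`,
`K' = 77760(5n_K + 2)`: `3–4–1` at `σ = 1 + 6(1 − β)` and heights `0, γ, 2γ`.
[cite: MontgomeryVaughan2007, Theorem 6.6 (proof)] -/
theorem zeroFree_far {β γ : ℝ} (hzero : dedekindZeta₁ K (β + γ * I) = 0) (hu0 : 0 < 1 - β)
    (husmall : 1 - β ≤ 1 / 64) (hfar : 30 * (1 - β) ≤ |γ|) :
    (1 / 25) * (1 / (1 - β)) ≤ 9 * (77760 * (5 * Module.finrank ℚ K + 2)) *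
      (Real.log ((discr K).natAbs : ℝ) + Real.log (|γ| + 4)) := by
  set Kc : ℝ := 77760 * (5 * Module.finrank ℚ K + 2) with hKc
  have hKc0 : 0 ≤ Kc := by positivity
  set u : ℝ := 1 - β with hu
  set Q : ℝ := ((discr K).natAbs : ℝ) with hQdef
  have hQ1 : 1 ≤ Q := by
    have h := Int.one_le_abs (NumberField.discr_ne_zero K)
    rw [Int.abs_eq_natAbs] at h
    rw [hQdef]; exact_mod_cast h
  set ℒ : ℝ := Real.log Q + Real.log (|γ| + 4) with hℒ
  have hℒ₀ℒ : Real.log Q + Real.log 4 ≤ ℒ := UniformTwistedZFRData.log_add_log_four_le Q γ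
  have hM : ∀ t : ℝ, 77760 * discBound K t ≤ Kc * (Real.log Q + Real.log (|t| + 4)) := fun t ↦ by
    have := discBound_le (K := K) t
    rw [hKc]; nlinarith
  have hΛ : ∀ m, 0 ≤ vonMangoldtNorm K m := vonMangoldtNorm_nonneg
  have hsum : ∀ s : ℂ, 1 < s.re → LSeriesSummable (fun m ↦ (vonMangoldtNorm K m : ℂ)) s :=
    fun s hs ↦ LSeriesSummable_vonMangoldtNorm hs
  set d : ℝ := 6 * u with hddef
  have hdpos : 0 < d := by positivity
  have hd1 : d ≤ 1 := by rw [hddef]; linarith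
  have hσ₀1 : 1 < 1 + d := by linarith
  have hσ₀2 : 1 + d ≤ 2 := by linarith
  have h341 := ClassicalZFRData.three_four_one hΛ hsum hσ₀1 γ
  -- (A0)
  have hA0 := re_LSeries_vonMangoldtNorm_le (K := K) (s := ((1 + d : ℝ) : ℂ)) (by simpa using hσ₀1)
    (by simpa using hσ₀2)
  have e0 : (1 / (((1 + d : ℝ) : ℂ) - 1)).re = 1 / d := by
    rw [show ((1 + d : ℝ) : ℂ) - 1 = ((d : ℝ) : ℂ) by push_cast; ring, ← Complex.ofReal_one,
      ← Complex.ofReal_div, Complex.ofReal_re]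
  rw [e0, Complex.ofReal_im] at hA0
  have hM0 : 77760 * discBound K 0 ≤ Kc * ℒ := by
    have := hM 0
    rw [abs_zero, zero_add] at this
    nlinarith
  -- (A1) at `1 + d + iγ`, keeping the zero `ρ`
  have hρdisc : (β + γ * I : ℂ) ∈ closedBall (2 + (((1 + d : ℝ) : ℂ) + γ * I).im * I) (31 / 16) := by
    have him : (((1 + d : ℝ) : ℂ) + γ * I).im = γ := by simp
    rw [him, mem_closedBall, dist_eq_norm,
      show (β : ℂ) + γ * I - (2 + γ * I) = ((β - 2 : ℝ) : ℂ) by push_cast; ring,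
      Complex.norm_real, Real.norm_eq_abs, abs_le]
    constructor <;> linarith
  have hA1 := re_LSeries_vonMangoldtNorm_le_of_zeros (K := K) (s := ((1 + d : ℝ) : ℂ) + γ * I)
    (by simp; linarith) (by simp; linarith) {(β + γ * I : ℂ)} (fun _ ↦ 1)
    (fun v hv ↦ by
      rw [Finset.mem_singleton] at hv
      rw [hv]
      exact ⟨hzero, hρdisc, one_le_analyticOrderAt_dedekindZeta₁ hzero⟩)
  rw [Finset.sum_singleton] at hA1
  have him1 : (((1 + d : ℝ) : ℂ) + γ * I).im = γ := by simp
  have e1 : (1 / ((((1 + d : ℝ) : ℂ) + γ * I) - 1)).re = d / (d ^ 2 + γ ^ 2) := by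
    rw [one_div, show (((1 + d : ℝ) : ℂ) + γ * I) - 1 = ((d : ℝ) : ℂ) + ((γ : ℝ) : ℂ) * I by push_cast; ring,
      DirichletZFR.re_inv_ofReal_add_mul_I]
  have e1' : (((((1 + d : ℝ) : ℂ) + γ * I) - (β + γ * I))⁻¹).re = 1 / (d + u) := by
    rw [show (((1 + d : ℝ) : ℂ) + γ * I) - (β + γ * I) = ((d + u : ℝ) : ℂ) by rw [hu]; push_cast; ring,
      ← Complex.ofReal_inv, Complex.ofReal_re, one_div]
  rw [him1, e1, e1'] at hA1
  simp only [Nat.cast_one, one_mul] at hA1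
  have hM1 : 77760 * discBound K γ ≤ Kc * ℒ := hM γ
  -- (A2) at `1 + d + 2iγ`
  have hA2 := re_LSeries_vonMangoldtNorm_le (K := K) (s := ((1 + d : ℝ) : ℂ) + (2 * γ) * I)
    (by simp; linarith) (by simp; linarith)
  have him2 : (((1 + d : ℝ) : ℂ) + (2 * γ) * I).im = 2 * γ := by simp
  have e2 : (1 / ((((1 + d : ℝ) : ℂ) + (2 * γ) * I) - 1)).re = d / (d ^ 2 + (2 * γ) ^ 2) := by
    rw [one_div, show (((1 + d : ℝ) : ℂ) + (2 * γ) * I) - 1 = ((d : ℝ) : ℂ) + ((2 * γ : ℝ) : ℂ) * I by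
        push_cast; ring, DirichletZFR.re_inv_ofReal_add_mul_I]
  rw [him2, e2] at hA2
  have hM2 : 77760 * discBound K (2 * γ) ≤ 2 * Kc * ℒ := by
    have h := hM (2 * γ)
    have h2 := TwistedZFR.ell_two_mul_le hQ1 γ
    rw [← hℒ] at h2
    nlinarith
  -- pole terms
  have hγ2 : 900 * u ^ 2 ≤ γ ^ 2 := by
    have h30 : 0 ≤ 30 * u := by positivity
    have := mul_le_mul hfar hfar h30 (abs_nonneg γ)
    rw [← pow_two, ← pow_two, sq_abs] at this
    nlinarith
  have hp1 : d / (d ^ 2 + γ ^ 2) ≤ 1 / (156 * u) := by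
    rw [div_le_div_iff₀ (by positivity) (by positivity), hddef]; nlinarith
  have hp2 : d / (d ^ 2 + (2 * γ) ^ 2) ≤ 1 / (606 * u) := by
    rw [div_le_div_iff₀ (by positivity) (by positivity), hddef]; nlinarith
  have e3 : 1 / d = 1 / (6 * u) := by rw [hddef]
  have e4 : 1 / (d + u) = 1 / (7 * u) := by rw [hddef]; ring_nf
  rw [e3] at hA0
  rw [e4] at hA1
  have hpt : (((1 + d : ℝ) : ℂ) + (2 * γ) * I) = ((1 + d : ℝ) : ℂ) + 2 * γ * I := by push_cast; ring
  rw [hpt] at hA2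
  have hkey : 4 * (1 / (7 * u)) - 3 * (1 / (6 * u)) - 4 * (1 / (156 * u)) - 1 / (606 * u) ≤
      9 * Kc * ℒ := by
    linarith [hA0, hA1, hA2, h341, hp1, hp2, hM0, hM1, hM2]
  have hv7 : 1 / (7 * u) = 1 / 7 * (1 / u) := by rw [one_div_mul_one_div]
  have hv6 : 1 / (6 * u) = 1 / 6 * (1 / u) := by rw [one_div_mul_one_div]
  have hv156 : 1 / (156 * u) = 1 / 156 * (1 / u) := by rw [one_div_mul_one_div]
  have hv606 : 1 / (606 * u) = 1 / 606 * (1 / u) := by rw [one_div_mul_one_div]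
  rw [hv7, hv6, hv156, hv606] at hkey
  have hv0 : 0 < 1 / u := by positivity
  nlinarith [hkey, hv0]

set_option maxHeartbeats 800000 in
/-- **NEAR zeros** (`0 < |γ| < 30(1 − β)`, Stark's device): if `ρ = β + iγ`, `γ ≠ 0`, is a zero of
`ζ₁_K` with `0 < 1 − β ≤ 1/64` and `|γ| < 30(1 − β)`, then
`(1/103)/(1 − β) ≤ K'(log|d_K| + log 4)`: `ρ̄` is a second zero, and at the real point
`σ = 1 + 62(1 − β)`, `0 ≤ L(Λ_K, σ) ≤ 1/(σ−1) − 2 Re 1/(σ − ρ) + K'ℒ₀`. [folklore] -/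
theorem zeroFree_near {β γ : ℝ} (hzero : dedekindZeta₁ K (β + γ * I) = 0) (hγ0 : γ ≠ 0)
    (hu0 : 0 < 1 - β) (husmall : 1 - β ≤ 1 / 64) (hnear : |γ| < 30 * (1 - β)) :
    (1 / 103) * (1 / (1 - β)) ≤ (77760 * (5 * Module.finrank ℚ K + 2)) *
      (Real.log ((discr K).natAbs : ℝ) + Real.log 4) := by
  set Kc : ℝ := 77760 * (5 * Module.finrank ℚ K + 2) with hKc
  set u : ℝ := 1 - β with hu
  set σ : ℝ := 1 + 62 * u with hσdef
  have hσ1 : 1 < σ := by rw [hσdef]; linarith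
  have hσ2 : σ ≤ 2 := by rw [hσdef]; linarith
  have hzero' : dedekindZeta₁ K (β - γ * I) = 0 := by
    have h := dedekindZeta₁_conj_eq_zero hzero
    rwa [map_add, map_mul, Complex.conj_ofReal, Complex.conj_ofReal, Complex.conj_I, mul_neg,
      ← sub_eq_add_neg] at h
  have hne : (β + γ * I : ℂ) ≠ β - γ * I := by
    intro h
    have := congrArg Complex.im h
    simp at this
    exact hγ0 (by linarith)
  have hγ2 : γ ^ 2 ≤ 900 * u ^ 2 := by
    have h30 : 0 ≤ 30 * u := by positivity
    have := mul_le_mul hnear.le hnear.le (abs_nonneg γ) h30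
    rw [← pow_two, ← pow_two, sq_abs] at this
    nlinarith
  have hb : (β - 2) ^ 2 ≤ (1 + 1 / 64) ^ 2 := by
    have h1 : 0 ≤ 2 - β := by linarith
    have h2 : 2 - β ≤ 1 + 1 / 64 := by linarith
    have := mul_le_mul h2 h2 h1 (by norm_num)
    nlinarith
  have hγ2' : γ ^ 2 ≤ 900 * (1 / 64) ^ 2 := by nlinarith
  have hdisc : ∀ e : ℝ, e ^ 2 = γ ^ 2 → (β + e * I : ℂ) ∈ closedBall (2 + ((σ : ℂ)).im * I) (31 / 16) := by
    intro e he
    rw [Complex.ofReal_im, Complex.ofReal_zero, zero_mul, add_zero, mem_closedBall, dist_eq_norm]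
    have hsq : ‖(β + e * I : ℂ) - 2‖ ^ 2 = (β - 2) ^ 2 + e ^ 2 := by
      rw [show (β : ℂ) + e * I - 2 = ((β - 2 : ℝ) : ℂ) + ((e : ℝ) : ℂ) * I by push_cast; ring,
        ← Complex.normSq_eq_norm_sq, Complex.normSq_add_mul_I]
    have hsq' : ‖(β + e * I : ℂ) - 2‖ ^ 2 ≤ (31 / 16) ^ 2 := by rw [hsq, he]; nlinarith
    exact (sq_le_sq₀ (norm_nonneg _) (by norm_num)).mp hsq'
  have hdisc₁ := hdisc γ rfl
  have hdisc₂ := hdisc (-γ) (by ring)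
  have hpt₂ : (β + (-γ : ℝ) * I : ℂ) = β - γ * I := by push_cast; ring
  rw [hpt₂] at hdisc₂
  have hA := re_LSeries_vonMangoldtNorm_le_of_zeros (K := K) (s := (σ : ℂ)) (by simpa using hσ1)
    (by simpa using hσ2) {(β + γ * I : ℂ), (β - γ * I : ℂ)} (fun _ ↦ 1)
    (fun v hv ↦ by
      have hv' : v = β + γ * I ∨ v = β - γ * I := by
        simpa [Finset.mem_insert, Finset.mem_singleton] using hv
      rcases hv' with h | h
      · rw [h]; exact ⟨hzero, hdisc₁, one_le_analyticOrderAt_dedekindZeta₁ hzero⟩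
      · rw [h]; exact ⟨hzero', hdisc₂, one_le_analyticOrderAt_dedekindZeta₁ hzero'⟩)
  rw [Finset.sum_pair hne, Complex.ofReal_im] at hA
  simp only [Nat.cast_one, one_mul] at hA
  have e0 : (1 / ((σ : ℂ) - 1)).re = 1 / (62 * u) := by
    rw [show (σ : ℂ) - 1 = ((62 * u : ℝ) : ℂ) by rw [hσdef]; push_cast; ring, ← Complex.ofReal_one,
      ← Complex.ofReal_div, Complex.ofReal_re]
  have e₁ : (((σ : ℂ) - (β + γ * I))⁻¹).re = (63 * u) / ((63 * u) ^ 2 + γ ^ 2) := by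
    rw [show (σ : ℂ) - (β + γ * I) = ((63 * u : ℝ) : ℂ) + ((-γ : ℝ) : ℂ) * I by rw [hσdef, hu]; push_cast; ring,
      DirichletZFR.re_inv_ofReal_add_mul_I]; ring
  have e₂ : (((σ : ℂ) - (β - γ * I))⁻¹).re = (63 * u) / ((63 * u) ^ 2 + γ ^ 2) := by
    rw [show (σ : ℂ) - (β - γ * I) = ((63 * u : ℝ) : ℂ) + ((γ : ℝ) : ℂ) * I by rw [hσdef, hu]; push_cast; ring,
      DirichletZFR.re_inv_ofReal_add_mul_I]
  rw [e0, e₁, e₂] at hA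
  have hM0 : 77760 * discBound K 0 ≤ Kc * (Real.log ((discr K).natAbs : ℝ) + Real.log 4) := by
    have := discBound_zero_le (K := K)
    rw [hKc]; nlinarith
  have hpos : 0 ≤ (LSeries (fun m ↦ (vonMangoldtNorm K m : ℂ)) σ).re := by
    have h := TwistedZFR.norm_LSeries_le_of_norm_le (f := fun m ↦ (vonMangoldtNorm K m : ℂ))
      (Λ₀ := vonMangoldtNorm K) (fun m ↦ by
        rw [Complex.norm_real, Real.norm_of_nonneg (vonMangoldtNorm_nonneg m)])
      (fun s hs ↦ LSeriesSummable_vonMangoldtNorm hs) (s := (σ : ℂ)) hσ1 (by simp)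
    exact (norm_nonneg _).trans h
  have hpair : 126 / (4869 * u) ≤ 2 * ((63 * u) / ((63 * u) ^ 2 + γ ^ 2)) := by
    rw [mul_div_assoc', div_le_div_iff₀ (by positivity) (by positivity)]; nlinarith
  have hkey : 126 / (4869 * u) - 1 / (62 * u) ≤ Kc * (Real.log ((discr K).natAbs : ℝ) + Real.log 4) := by
    linarith [hA, hpos, hpair, hM0]
  have hv1 : 126 / (4869 * u) = 126 / 4869 * (1 / u) := by rw [mul_one_div, div_div]
  have hv2 : 1 / (62 * u) = 1 / 62 * (1 / u) := by rw [one_div_mul_one_div]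
  rw [hv1, hv2] at hkey
  have hv0 : 0 < 1 / u := by positivity
  nlinarith [hkey, hv0]

/-- **The zero-free region for `ζ_K`, uniformly in the field** (Lagarias–Odlyzko Lemma 8.1 with
Stark's Lemma; [ThornerZaman2019, Theorem 3.1], `χ = 1`): for every `n` there is `c = c(n) > 0`
such that for every number field `K` of degree `n` and every zero `ρ` of `ζ₁_K(s) = (s − 1)ζ_K(s)`
with `Re ρ > 1 − c/(log|d_K| + log(|Im ρ| + 4))`, `Im ρ = 0`.
[cite: LagariasOdlyzko1977, Lemma 8.1] -/
theorem exists_zeroFree_dedekindZeta₁ (n : ℕ) :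
    ∃ c : ℝ, 0 < c ∧ ∀ (K : Type) [Field K] [NumberField K], Module.finrank ℚ K = n →
      ∀ ρ : ℂ, dedekindZeta₁ K ρ = 0 →
        1 - c / (Real.log ((discr K).natAbs : ℝ) + Real.log (|ρ.im| + 4)) < ρ.re → ρ.im = 0 := by
  set Kc : ℝ := 77760 * (5 * n + 2) with hKc
  have hKcpos : 0 < Kc := by rw [hKc]; positivity
  set c : ℝ := min (1 / 64) (1 / (225 * Kc + 1)) with hcdef
  have hc : 0 < c := lt_min (by norm_num) (by positivity)
  have hc64 : c ≤ 1 / 64 := min_le_left _ _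
  have hcK : c ≤ 1 / (225 * Kc + 1) := min_le_right _ _
  refine ⟨c, hc, fun K _ _ hK ρ hzero hregion ↦ ?_⟩
  subst hK
  by_contra hγ0
  have hρ : ρ = (ρ.re : ℂ) + (ρ.im : ℂ) * I := (Complex.re_add_im ρ).symm.trans (by simp [mul_comm])
  have hzero' : dedekindZeta₁ K ((ρ.re : ℂ) + (ρ.im : ℂ) * I) = 0 := by rw [← hρ]; exact hzero
  have hQ1 : (1 : ℝ) ≤ ((discr K).natAbs : ℝ) := by
    have h := Int.one_le_abs (NumberField.discr_ne_zero K)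
    rw [Int.abs_eq_natAbs] at h
    exact_mod_cast h
  set ℒ : ℝ := Real.log ((discr K).natAbs : ℝ) + Real.log (|ρ.im| + 4) with hℒ
  have hℒ1 : 1 ≤ ℒ := TwistedZFR.one_le_ell hQ1 ρ.im
  have hℒ0 : 0 < ℒ := by linarith
  have hℒ₀ℒ : Real.log ((discr K).natAbs : ℝ) + Real.log 4 ≤ ℒ :=
    UniformTwistedZFRData.log_add_log_four_le _ ρ.im
  have hcℒ : c / ℒ ≤ c := div_le_self hc.le hℒ1
  have hβ1 : ρ.re < 1 := by
    by_contra h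
    exact dedekindZeta₁_ne_zero_of_one_le_re (K := K) (s := ρ) (not_lt.mp h) hzero
  have hu0 : 0 < 1 - ρ.re := by linarith
  have hularge : 1 - ρ.re < c / ℒ := by linarith
  have husmall : 1 - ρ.re ≤ 1 / 64 := by linarith
  have hc' : c * (225 * Kc + 1) ≤ 1 := by
    rw [le_div_iff₀ (by positivity)] at hcK; linarith
  rcases le_or_gt (30 * (1 - ρ.re)) |ρ.im| with hfar | hnear
  · have h : (1 / 25) * (1 / (1 - ρ.re)) ≤ 9 * Kc * ℒ := zeroFree_far hzero' hu0 husmall hfar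
    have h1 : 1 / 25 ≤ 9 * Kc * ℒ * (1 - ρ.re) := by
      have := mul_le_mul_of_nonneg_right h hu0.le
      rwa [mul_assoc (1 / 25 : ℝ), one_div_mul_cancel hu0.ne', mul_one] at this
    have h2 : 1 / (225 * Kc) ≤ ℒ * (1 - ρ.re) := by
      rw [div_le_iff₀ (by positivity)]; nlinarith [h1]
    have h3 : c ≤ 1 / (225 * Kc) :=
      hcK.trans (one_div_le_one_div_of_le (by positivity) (by linarith))
    have hfinal : c / ℒ ≤ 1 - ρ.re := by
      rw [div_le_iff₀ hℒ0]; nlinarith [h2, h3]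
    linarith
  · have h : (1 / 103) * (1 / (1 - ρ.re)) ≤ Kc * (Real.log ((discr K).natAbs : ℝ) + Real.log 4) :=
      zeroFree_near hzero' hγ0 hu0 husmall hnear
    have h1 : 1 / 103 ≤ Kc * ℒ * (1 - ρ.re) := by
      have := mul_le_mul_of_nonneg_right h hu0.le
      rw [mul_assoc (1 / 103 : ℝ), one_div_mul_cancel hu0.ne', mul_one] at this
      have hKℒ : Kc * (Real.log ((discr K).natAbs : ℝ) + Real.log 4) ≤ Kc * ℒ :=
        mul_le_mul_of_nonneg_left hℒ₀ℒ hKcpos.le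
      have := mul_le_mul_of_nonneg_right hKℒ hu0.le
      linarith
    have h2 : 1 / (103 * Kc) ≤ ℒ * (1 - ρ.re) := by
      rw [div_le_iff₀ (by positivity)]; nlinarith [h1]
    have h3 : c ≤ 1 / (103 * Kc) :=
      hcK.trans (one_div_le_one_div_of_le (by positivity) (by linarith))
    have hfinal : c / ℒ ≤ 1 - ρ.re := by
      rw [div_le_iff₀ hℒ0]; nlinarith [h2, h3]
    linarith

/-- The same for the continued `ζ_K` (`dedekindZetaCont`), `ρ ≠ 1`. [cite: LagariasOdlyzko1977, Lemma 8.1] -/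
theorem exists_zeroFree_dedekindZetaCont (n : ℕ) :
    ∃ c : ℝ, 0 < c ∧ ∀ (K : Type) [Field K] [NumberField K], Module.finrank ℚ K = n →
      ∀ ρ : ℂ, ρ ≠ 1 → dedekindZetaCont K ρ = 0 →
        1 - c / (Real.log ((discr K).natAbs : ℝ) + Real.log (|ρ.im| + 4)) < ρ.re → ρ.im = 0 := by
  obtain ⟨c, hc, h⟩ := exists_zeroFree_dedekindZeta₁ n
  refine ⟨c, hc, fun K _ _ hK ρ hρ1 hρ hregion ↦ h K hK ρ ?_ hregion⟩
  rw [dedekindZeta₁_apply_of_ne_one hρ1, hρ, mul_zero]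

end Literature.NumberTheory.LFunctions.NumberField

end
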